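import Summits.HodgeConjecture.HodgeConjecture.Theorems.AmpleAdicLefschetzSectionalSourceIffHodgeConjecture

/-!
# Crux `SectionalSource` (stmt-HodgeConjecture-10725) — STRATEGY CENSUS, kernel-checked part

Crux-strategist evidence (unit `cstrat-stmt-HodgeConjecture-10725-q1`, suspect = equivalence).
Companion of `STRATEGY-CENSUS.md` (§ Decomposition). Sorry-free; imports only the landed
characterisation file `Theorems/AmpleAdicLefschetzSectionalSourceIffHodgeConjecture.lean`.

What is checked here:

* `sectionalSource_iff_forall_sliceP` — SS is the conjunction of its codimension slices
  `SliceP p` (SS for one `p`, all `n ≥ 2p + 1`).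
* `sliceP_iff_hm` — **each slice is already a middle-degree Hodge conjecture**:
  `SliceP p ↔ HM p` (HM p = every rational `(p,p)`-class on every smooth projective `2p`-fold is
  algebraic). Forward: the product trick `X₀ × ℙ¹` (tree theorem
  `mem_algebraicClasses_middle_of_affineComplSections`); backward: the GRADED form of the landed
  composition `ampleAdicLefschetz_sectionalSource_of_hodgeMiddle` (it uses middle-degree HC only in
  dimension `2p`).
* `sliceP_zero`, `sliceP_one` — the slices `p ≤ 1` are theorems (`algebraicClasses_zero`,
  Lefschetz `(1,1)`); `sliceP_two_iff` — the first open slice is HC for `(2,2)`-classes on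
  fourfolds.
* `critical_iff_hodgeConjecture` — **the critical range slice `n = 2p + 1` of SS (all `p`) is by
  itself equivalent to the summit**; so the range split "critical slice ∧ strict sub-middle range"
  has a summit-equivalent piece.
* `mem_algebraicClasses_of_two_mul_add_eq_of_hodgeMiddle_graded` (namespace
  `Literature.AlgebraicGeometry.HodgeTheory`) — the GRADED product half of BFNP Lemma 48: verbatim
  the tree's `mem_algebraicClasses_of_two_mul_add_eq_of_cupPreservesHodgeType` with its global
  middle-degree hypothesis replaced by the single dimension `2(p + r)` it uses.
* `hm_descend : HM (p+1) → HM p`, `hm_of_le`, `sliceP_of_le` — **the middle-degree Hodge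
  conjectures are MONOTONE**: a later slice carries every earlier one (graded product half at
  `r = 1` on `X₀ × ℙ¹ × ℙ¹` + the `ℙ¹`-step of the proved route item `MiddleStabilisation`; named
  facts = the tree's discharged `…_holds`).
* `tailFrom_iff_hodgeConjecture : ∀ p₀, TailFrom p₀ ↔ HodgeConjecture` — **every cofinal family of
  slices is the summit**; the only non-summit pieces of SS cut along `p` are finite truncations
  (HC in degrees `≤ 2p₀`), and their complements are summit-equivalent.
* `sectionalSource_of_truncation` — the best typed split found, the TRUNCATION split
  `SliceP 2 ∧ TailFrom 3 → SectionalSource` (assembly proved, trivial seam), recorded and NOT filed: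
  its tail piece is the summit (`tailFrom_three_iff_hodgeConjecture`), so redirect condition (c)
  fails.

All theorems sorry-free with axioms `propext / Classical.choice / Quot.sound`
(`lean check --axioms tailFrom_iff_hodgeConjecture`, farm 2026-08-17).
-/

noncomputable section

set_option linter.dupNamespace false

open CategoryTheory AlgebraicGeometry
open Literature.AlgebraicGeometry Literature.AlgebraicGeometry.Motives Literature.AlgebraicGeometry.HodgeTheory
open Summit.HodgeConjecture.HodgeConjecture.Theses.AmpleAdicLefschetz
open Summit.HodgeConjecture.HodgeConjecture.Theorems


namespace Literature.AlgebraicGeometry.HodgeTheory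

open scoped Manifold ContDiff
open CategoryTheory.Limits MonoidalCategory CartesianMonoidalCategory
open Literature.AlgebraicTopology.SingularHomology

/-- **Graded product half of BFNP Lemma 48** — verbatim the tree's
`mem_algebraicClasses_of_two_mul_add_eq_of_cupPreservesHodgeType` (file
`MiddleDimensionReductionOfHodgeModels`) with its GLOBAL middle-degree hypothesis replaced by the
one dimension it actually uses, `2(p + r)`: for `X` smooth projective of dimension `n = 2p + r`,
`r ≥ 1`, and `c` a rational `(p,p)`-class, if every rational middle-degree Hodge class on every
smooth projective `2(p+r)`-fold is algebraic then `c` is algebraic (`c' = pr₁^* c ∪ pr₂^* ρ` on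
`X × ℙʳ`, `c = λ⁻¹ pr_{1*} c'`). [cite: BrosnanFangNiePearlstein2009, §6 Lemma 48 (proof, case dim Y < 2k)]
[cite: VoisinHodgeI2002, §7.3.2 and §11.1.2] -/
theorem mem_algebraicClasses_of_two_mul_add_eq_of_hodgeMiddle_graded
    (hI : hodgePQ_independent_of_hodgeModel)
    (hA : ∀ ⦃n : ℕ⦄ ⦃X : Motives.SchemeOver ℂ⦄, nonempty_hodgeModel n X)
    (hcup : ∀ ⦃n : ℕ⦄ ⦃X : Motives.SchemeOver ℂ⦄, Motives.IsSmoothProjective n X →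
      CupPreservesHodgeType n X)
    {n : ℕ} {X : Motives.SchemeOver ℂ} (hX : Motives.IsSmoothProjective n X) {p r : ℕ}
    (hmid : ∀ ⦃Y : Motives.SchemeOver ℂ⦄, Motives.IsSmoothProjective (2 * (p + r)) Y →
      ∀ c : complexBetti Y (2 * (p + r)), IsRationalClass c →
        IsOfHodgeType (2 * (p + r)) Y (2 * (p + r)) (p + r) (p + r) c →
        c ∈ algebraicClasses Y (p + r))
    (hr : 2 * p + r = n) (hr1 : 1 ≤ r) (c : complexBetti X (2 * p)) (hc : IsRationalClass c)
    (hpp : IsOfHodgeType n X (2 * p) p p c) : c ∈ algebraicClasses X p := by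
  -- an orientation family (orientations of the closed manifolds `Y(ℂ)` exist) and its duality
  let μ : OrientationFamily := fun n Y hY ↦ (Motives.ComplexPoints.isOrientableOver ℂ hY).some
  have hμ : μ.HasPoincareDuality := OrientationFamily.hasPoincareDuality μ
  have hS := gysinMap_restrictCompl_eq_zero_of_field.{0, 0} ℂ
  -- the auxiliary factor `P = ℙʳ`, a complex point `t`, the even-dimensional `V = X × P`
  set P := Motives.projectiveSpace r ℂ with hPdef
  have hP : Motives.IsSmoothProjective r P := Motives.isSmoothProjective_projectiveSpace_holds ℂ r
  haveI := connectedSpace_complexPoints hP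
  obtain ⟨t⟩ : Nonempty (Motives.ComplexPoints P) := inferInstance
  haveI := connectedSpace_complexPoints hX
  obtain ⟨x₀⟩ : Nonempty (Motives.ComplexPoints X) := inferInstance
  have hV : Motives.IsSmoothProjective (n + r) (X ⊗ P) := Motives.IsSmoothProjective.tensor_holds hX hP
  haveI : LocallyOfFiniteType P.hom := locallyOfFiniteType_of_isSmoothProjective hP
  haveI : IsClosedImmersion (Motives.sliceAt X t).left := Motives.isClosedImmersion_sliceAt_left t
  haveI := pathConnectedSpace_complexPoints hX
  -- a non-zero rational top-degree class `ρ` on `P`, of type `(r, r)`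
  obtain ⟨ρ, hρ, hρ0⟩ := exists_isRationalClass_ne_zero_of_degree_eq_two_mul hP
  obtain ⟨B⟩ := (hA (n := r) (X := P)).nonempty hP
  have hρtyp : IsOfHodgeType r P (2 * r) r r ρ := isOfHodgeType_of_degree_eq_two_mul B ρ
  -- `pr₂^* ρ` dies off the slice `s_t(X) = pr₂⁻¹(t)` …
  have hρsupp : complexBetti.restrictCompl (X ⊗ P) (Set.range (Motives.sliceAt X t).left.base)
      (2 * r) (complexBetti.map (snd X P) (2 * r) ρ) = 0 := by
    rw [range_sliceAt_left_base]
    exact complexBetti.restrictCompl_map_eq_zero (snd X P) (restrictCompl_pt_eq_zero hP hr1 t ρ)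
  -- … hence is a Gysin image `s_{t*} y`, `y ∈ H⁰(X(ℂ); ℂ) = ℂ · 1`: `pr₂^* ρ = λ · s_{t*} 1`
  obtain ⟨y, hy⟩ := exists_complexGysin_eq_of_isClosedImmersion μ hV hX (Motives.sliceAt X t)
    (show 0 + 2 * (n + r) = 2 * r + 2 * n by ring) hρsupp
  obtain ⟨lam, rfl⟩ := singularCohomology.exists_eq_smul_one y
  rw [map_smul] at hy
  -- `λ ≠ 0`: `pr₂^*` is injective (`pr₂` has the section `(x₀, 𝟙)`) and `ρ ≠ 0`
  have hlam : lam ≠ 0 := by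
    rintro rfl
    rw [zero_smul] at hy
    apply hρ0
    let j : P ⟶ X ⊗ P := CartesianMonoidalCategory.lift (Motives.toSpecOver P ≫ x₀) (𝟙 P)
    have hj : j ≫ snd X P = 𝟙 P := CartesianMonoidalCategory.lift_snd _ _
    have hρj : complexBetti.map j (2 * r) (complexBetti.map (snd X P) (2 * r) ρ) = ρ := by
      rw [← CategoryTheory.comp_apply, ← complexBetti.map_comp, hj, complexBetti.map_id,
        CategoryTheory.id_apply]
    rw [← hρj, ← hy, map_zero]
  -- the middle-degree class `c' = pr₁^* c ∪ pr₂^* ρ` on `V`: rational, of type `(p + r, p + r)`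
  set c' : complexBetti (X ⊗ P) (2 * (p + r)) :=
    cupProduct (show 2 * p + 2 * r = 2 * (p + r) by ring) (complexBetti.map (fst X P) (2 * p) c)
      (complexBetti.map (snd X P) (2 * r) ρ) with hc'def
  have hc'rat : IsRationalClass c' := (hc.map _).cup _ (hρ.map _)
  have hc'typ : IsOfHodgeType (n + r) (X ⊗ P) (2 * (p + r)) (p + r) (p + r) c' :=
    hcup hV _ (preservesHodgeType_of_nonempty_hodgeModel hI (hA (X := X ⊗ P)) hV hX (fst X P) hpp)
      (preservesHodgeType_of_nonempty_hodgeModel hI (hA (X := X ⊗ P)) hV hP (snd X P) hρtyp)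
  -- `V` has the even dimension `n + r = 2(p + r)`: `c'` is algebraic by hypothesis
  have hdim : n + r = 2 * (p + r) := by omega
  have hV' : Motives.IsSmoothProjective (2 * (p + r)) (X ⊗ P) := hdim ▸ hV
  rw [hdim] at hc'typ
  have halg : c' ∈ algebraicClasses (X ⊗ P) (p + r) := hmid hV' c' hc'rat hc'typ
  -- `pr_{1*} c' ∈ Nᵖ H²ᵖ(X(ℂ); ℂ)` (Gysin maps and supports)
  have hpush : complexGysin μ hV hX (fst X P) (show 2 * (p + r) + 2 * n = 2 * p + 2 * (n + r) by ring)
      c' ∈ algebraicClasses X p :=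
    complexGysin_mem_supportedClasses hS μ hμ hV hX (fst X P) _ (by omega) halg
  -- `pr_{1*} c' = c ∪ pr_{1*} pr₂^* ρ = c ∪ λ · (s_t ≫ pr₁)_* 1 = λ c`
  have hone : complexGysin μ hV hX (fst X P) (show 2 * r + 2 * n = 0 + 2 * (n + r) by ring)
      (complexBetti.map (snd X P) (2 * r) ρ) = lam • singularCohomology.one ℂ (Motives.ComplexPoints X) := by
    rw [← hy, map_smul, ← LinearMap.comp_apply,
      ← complexGysin_comp hμ hX hV hX (Motives.sliceAt X t) (fst X P)]
    simp only [Motives.sliceAt_fst]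
    rw [complexGysin_id hμ hX 0, LinearMap.id_apply]
  have hcc : complexGysin μ hV hX (fst X P) (show 2 * (p + r) + 2 * n = 2 * p + 2 * (n + r) by ring)
      c' = lam • c := by
    rw [hc'def, complexGysin_cup hμ hV hX (fst X P) _ _
      (show 2 * r + 2 * n = 0 + 2 * (n + r) by ring) (Nat.add_zero (2 * p)), hone,
      LinearMap.map_smul, cupProduct_one]
  rw [hcc] at hpush
  have h := Submodule.smul_mem _ lam⁻¹ hpush
  rwa [smul_smul, inv_mul_cancel₀ hlam, one_smul] at h

end Literature.AlgebraicGeometry.HodgeTheory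

namespace Summit.HodgeConjecture.HodgeConjecture.Cruxes.SectionalSource.Census

open MonoidalCategory CartesianMonoidalCategory

/-- The conclusion of `SectionalSource` at `(n, p, X, c)`: an admissible proper section on which
`c` becomes algebraic (verbatim the existential of the route decl). -/
abbrev Witness (n p : ℕ) (X : SchemeOver ℂ) (c : complexBetti X (2 * p)) : Prop :=
  ∃ (m : ℕ) (Y : SchemeOver ℂ) (f : Y ⟶ X) (s : Finset X.left.Opens),
    IsSmoothProjective m Y ∧ IsClosedImmersion f.left ∧ (∀ U ∈ s, IsAffineOpen U) ∧
      (⋃ U ∈ s, (U : Set X.left)) = (Set.range f.left.base)ᶜ ∧ 2 * p + s.card ≤ n ∧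
      Set.Nonempty (Set.range f.left.base)ᶜ ∧ complexBetti.map f (2 * p) c ∈ algebraicClasses Y p

/-- The codimension-`p` slice of `SectionalSource` (all dimensions `n ≥ 2p + 1`). -/
def SliceP (p : ℕ) : Prop :=
  ∀ ⦃n : ℕ⦄ ⦃X : SchemeOver ℂ⦄, IsSmoothProjective n X → 2 * p + 1 ≤ n →
    ∀ c : complexBetti X (2 * p), IsRationalClass c → IsOfHodgeType n X (2 * p) p p c →
      Witness n p X c

/-- The critical range slice `n = 2p + 1` of `SectionalSource` (all `p`; one affine complement
piece is then forced). -/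
def Critical : Prop :=
  ∀ ⦃p : ℕ⦄ ⦃X : SchemeOver ℂ⦄, IsSmoothProjective (2 * p + 1) X →
    ∀ c : complexBetti X (2 * p), IsRationalClass c → IsOfHodgeType (2 * p + 1) X (2 * p) p p c →
      Witness (2 * p + 1) p X c

/-- `HM p`: the Hodge conjecture in the middle degree `2p` of every smooth projective `2p`-fold. -/
def HM (p : ℕ) : Prop :=
  ∀ ⦃X₀ : SchemeOver ℂ⦄, IsSmoothProjective (2 * p) X₀ →
    ∀ c₀ : complexBetti X₀ (2 * p), IsRationalClass c₀ → IsOfHodgeType (2 * p) X₀ (2 * p) p p c₀ →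
      c₀ ∈ algebraicClasses X₀ p

/-- Tails of slices: `SliceP p` for all `p ≥ p₀`. -/
def TailFrom (p₀ : ℕ) : Prop :=
  ∀ ⦃p : ℕ⦄, p₀ ≤ p → SliceP p

/-- `SectionalSource` is the conjunction of its codimension slices. -/
theorem sectionalSource_iff_forall_sliceP : SectionalSource ↔ ∀ p, SliceP p :=
  ⟨fun h _ _ _ hX hp c hc hh => h hX hp c hc hh, fun h _ p _ hX hp c hc hh => h p hX hp c hc hh⟩

/-- `TailFrom 0` is `SectionalSource` again. -/
theorem tailFrom_zero_iff : TailFrom 0 ↔ SectionalSource := by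
  rw [sectionalSource_iff_forall_sliceP]
  exact ⟨fun h p => h (Nat.zero_le p), fun h p _ => h p⟩

/-- **Slice `p` ⇒ `HM p`** — the product trick `X₀ × ℙ¹`, dominance of one-affine-complement
sections and the degree trick (tree theorem `mem_algebraicClasses_middle_of_affineComplSections`),
fed with the slice at its critical dimension `2p + 1`.
[cite: VoisinHodgeI2002, §7.3.2 Remark 7.29] [cite: Deligne2000, §1] -/
theorem hm_of_sliceP {p : ℕ} (h : SliceP p) : HM p := fun _ hX₀ c₀ hc hh =>
  mem_algebraicClasses_middle_of_affineComplSections (fun _ hX c hc' hh' => h hX le_rfl c hc' hh')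
    hX₀ c₀ hc hh

/-- **`HM p` ⇒ slice `p`** — graded form of the landed
`ampleAdicLefschetz_sectionalSource_of_hodgeMiddle`: for `p ≤ 1 ∨ n ≤ 4` the landed calibration
`stub_lowDegree` + Bertini supply `stub_supply`; for `p ≥ 2` cut `X` by `n − 2p` hyperplane sections
(`stub_iteratedSupply`) to a smooth `Y` of dimension exactly `2p`, where `f^* c` is a rational
`(p,p)`-class in the MIDDLE degree, algebraic by `HM p` — middle-degree HC is used in dimension `2p`
only. [cite: Deligne2000, §1] [cite: Hartshorne1977, II Thm. 8.18 and II Prop. 2.5] -/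
theorem sliceP_of_hm {p : ℕ} (hMid : HM p) : SliceP p := by
  intro n X hX hp c hc hh
  by_cases hlow : p ≤ 1 ∨ n ≤ 4
  · exact stub_lowDegree stub_supply hX hp hlow c hc hh
  · obtain ⟨Y, f, s, hY, hf, hs, hcov, hcard, hne⟩ :=
      stub_iteratedSupply hX (show 1 ≤ n - 2 * p by omega) (show n - 2 * p + 1 ≤ n by omega)
    have hdim : n - (n - 2 * p) = 2 * p := by omega
    rw [hdim] at hY
    haveI := hf
    refine ⟨2 * p, Y, f, s, hY, hf, hs, hcov, by omega, hne, ?_⟩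
    obtain ⟨B⟩ := (nonempty_hodgeModel_holds (n := 2 * p) (X := Y)) hY
    have hrat : IsRationalClass (complexBetti.map f (2 * p) c) :=
      hc.map (AlgPoints.mapContinuous (L := ℂ) f)
    have hhdg : IsOfHodgeType (2 * p) Y (2 * p) p p (complexBetti.map f (2 * p) c) :=
      hh.map_of_le hY hX B f (by omega)
    exact hMid hY _ hrat hhdg

/-- **Each codimension slice of SS is a middle-degree Hodge conjecture**: `SliceP p ↔ HM p`.
[cite: Deligne2000, §1] [cite: VoisinHodgeI2002, §7.3.2 Remark 7.29] -/
theorem sliceP_iff_hm (p : ℕ) : SliceP p ↔ HM p := ⟨hm_of_sliceP, sliceP_of_hm⟩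

/-- The slice `p = 0` is a theorem (`algebraicClasses X 0 = ⊤`). -/
theorem sliceP_zero : SliceP 0 :=
  sliceP_of_hm fun X₀ _ _ _ _ => by
    rw [algebraicClasses_zero]
    trivial

/-- The slice `p = 1` is a theorem (Lefschetz `(1,1)` on surfaces, `lefschetzOneOne_rational_holds`).
[cite: VoisinHodgeI2002, Thm. 11.30] -/
theorem sliceP_one : SliceP 1 :=
  sliceP_of_hm fun _ hX₀ c₀ hc hh => lefschetzOneOne_rational_holds hX₀ c₀ hc hh

/-- The first open slice `p = 2` is exactly the Hodge conjecture for `(2,2)`-classes on smooth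
projective fourfolds. [cite: Deligne2000, §1] -/
theorem sliceP_two_iff :
    SliceP 2 ↔ ∀ ⦃X₀ : SchemeOver ℂ⦄, IsSmoothProjective 4 X₀ →
      ∀ c₀ : complexBetti X₀ 4, IsRationalClass c₀ → IsOfHodgeType 4 X₀ 4 2 2 c₀ →
        c₀ ∈ algebraicClasses X₀ 2 :=
  sliceP_iff_hm 2

/-- **The critical range slice alone is the summit**: SS restricted to `dim X = 2p + 1` (all `p`)
is equivalent to `HodgeConjecture` — forward by the product trick in every `p` and BFNP Lemma 48
(`hodgeConjectureFor_of_middleDimension_holds`), backward by specialising the landed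
`ampleAdicLefschetz_sectionalSource_of_hodgeConjecture`. Hence the range split
"critical slice ∧ strict sub-middle range" of SS has a summit-equivalent piece.
[cite: BrosnanFangNiePearlstein2009, §6 Lemma 48] [cite: Deligne2000, §1] -/
theorem critical_iff_hodgeConjecture : Critical ↔ _root_.HodgeConjecture := by
  constructor
  · intro h n X hX
    exact hodgeConjectureFor_of_middleDimension_holds
      (fun p X₀ hX₀ c₀ hc hh => mem_algebraicClasses_middle_of_affineComplSections
        (fun X' hX' c hc' hh' => h hX' c hc' hh') hX₀ c₀ hc hh) hX
  · intro hHC p X hX c hc hh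
    exact ampleAdicLefschetz_sectionalSource_of_hodgeConjecture hHC hX le_rfl c hc hh

/-- Every single slice is implied by the summit (so every slice and every tail is HC-implied; a
split of SS by slices is a split into consequences of the summit, as route items must be). -/
theorem sliceP_of_hodgeConjecture (hHC : _root_.HodgeConjecture) (p : ℕ) : SliceP p :=
  fun _ _ hX hp c hc hh => ampleAdicLefschetz_sectionalSource_of_hodgeConjecture hHC hX hp c hc hh

/-- **The truncation split, typed, with its assembly proved** (best candidate decomposition of the
census, § Decomposition): `SectionalSource` follows from its first open slice `SliceP 2` (HC for
fourfold `(2,2)`-classes) and the tail `TailFrom 3`; the slices `p ≤ 1` are theorems. NOT filed as a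
route split: the tail piece is summit-equivalent (`tailFrom_three_iff_hodgeConjecture` below, by the
monotonicity `hm_descend`), so redirect condition (c) "no piece gives S on its own" fails. -/
theorem sectionalSource_of_truncation (h₂ : SliceP 2) (h₃ : TailFrom 3) : SectionalSource := by
  rw [sectionalSource_iff_forall_sliceP]
  intro p
  rcases Nat.lt_or_ge p 3 with hp | hp
  · interval_cases p
    · exact sliceP_zero
    · exact sliceP_one
    · exact h₂
  · exact h₃ hp

/-- Conversely both truncation pieces are consequences of SS (hence of the summit). -/
theorem truncation_of_sectionalSource (h : SectionalSource) : SliceP 2 ∧ TailFrom 3 := by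
  rw [sectionalSource_iff_forall_sliceP] at h
  exact ⟨h 2, fun p _ => h p⟩


/-- **Monotonicity of the middle-degree Hodge conjecture**: `HM (p+1) → HM p`. For `X₀` of
dimension `2p` and a rational `(p,p)`-class `c₀`: HC for `X₀ × ℙ¹` in degree `2p` follows from
`HM (p+1)` by the graded product half at `r = 1` (`c′ = pr₁^* κ ∪ pr₂^* ρ` on `X₀ × ℙ¹ × ℙ¹`), and
`c₀ = s_t^* pr₁^* c₀` for a general slice (the `ℙ¹`-step
`mem_algebraicClasses_of_projectiveLine_of_preservesHodgeType`, as in the proved route item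
`MiddleStabilisation`). Named facts are the tree's discharged ones (`…_holds`).
[cite: BrosnanFangNiePearlstein2009, §6 Lemma 48] [cite: VoisinHodgeI2002, §7.3.2] -/
theorem hm_descend {p : ℕ} (h : HM (p + 1)) : HM p := by
  intro X₀ hX₀ c₀ hc hh
  have hP1 : IsSmoothProjective 1 (projectiveSpace 1 ℂ) := isSmoothProjective_projectiveSpace_holds ℂ 1
  have hX : IsSmoothProjective (2 * p + 1) (X₀ ⊗ projectiveSpace 1 ℂ) :=
    IsSmoothProjective.tensor_holds hX₀ hP1
  have hfst : PreservesHodgeType (2 * p + 1) (2 * p) (fst X₀ (projectiveSpace 1 ℂ)) :=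
    preservesHodgeType_of_nonempty_hodgeModel hodgePQ_independent_of_hodgeModel_holds
      nonempty_hodgeModel_holds hX hX₀ (fst X₀ (projectiveSpace 1 ℂ))
  refine mem_algebraicClasses_of_projectiveLine_of_preservesHodgeType hX₀ hfst ?_ c₀ hc hh
  intro κ hκ hκpp
  exact mem_algebraicClasses_of_two_mul_add_eq_of_hodgeMiddle_graded
    hodgePQ_independent_of_hodgeModel_holds (fun _ _ => nonempty_hodgeModel_holds)
    (fun _ _ hY => cupPreservesHodgeType_of_nonempty_hodgeModel hodgePQ_independent_of_hodgeModel_holds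
      nonempty_hodgeModel_holds
      (fun E _ _ _ => Literature.NumberTheory.Transcendental.exists_deRhamIsoFamily_holds E) hY)
    hX (p := p) (r := 1) h rfl le_rfl κ hκ hκpp

/-- Iterated monotonicity: `HM q → HM p` for `p ≤ q`. -/
theorem hm_of_le {p q : ℕ} (hpq : p ≤ q) (h : HM q) : HM p := by
  induction q, hpq using Nat.le_induction with
  | base => exact h
  | succ q _ ih => exact ih (hm_descend h)

/-- **Every tail of slices is the summit**: for every `p₀`, `TailFrom p₀ ↔ HodgeConjecture`.
A cofinal family of slices gives every `HM p` (monotonicity), hence every slice, hence SS, hence the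
summit (`ampleAdicLefschetz_sectionalSource_iff_hodgeConjecture`). So ANY split of `SectionalSource`
by codimension has a summit-equivalent piece; the only non-summit pieces are finite truncations
`p ≤ p₀` (HC in degrees `≤ 2p₀`), whose complements are summit-equivalent.
[cite: BrosnanFangNiePearlstein2009, §6 Lemma 48] [cite: Deligne2000, §1] -/
theorem tailFrom_iff_hodgeConjecture (p₀ : ℕ) : TailFrom p₀ ↔ _root_.HodgeConjecture := by
  constructor
  · intro h
    refine ampleAdicLefschetz_hodgeConjecture_of_sectionalSource ?_
    rw [sectionalSource_iff_forall_sliceP]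
    intro p
    rcases Nat.lt_or_ge p p₀ with hp | hp
    · exact sliceP_of_hm (hm_of_le hp.le (hm_of_sliceP (h le_rfl)))
    · exact h hp
  · intro hHC p _
    exact sliceP_of_hodgeConjecture hHC p

/-- In particular the tail piece of the truncation split is the summit:
`TailFrom 3 ↔ HodgeConjecture`. -/
theorem tailFrom_three_iff_hodgeConjecture : TailFrom 3 ↔ _root_.HodgeConjecture :=
  tailFrom_iff_hodgeConjecture 3

/-- And every single slice beyond a given one carries all the lower ones: `SliceP q → SliceP p`
for `p ≤ q` — no slice, range or tail of `SectionalSource` is a proper sub-problem of a later one. -/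
theorem sliceP_of_le {p q : ℕ} (hpq : p ≤ q) (h : SliceP q) : SliceP p :=
  sliceP_of_hm (hm_of_le hpq (hm_of_sliceP h))

end Summit.HodgeConjecture.HodgeConjecture.Cruxes.SectionalSource.Census

end
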